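import Mathlib
import HarnessLib
import Summits.HubbardSuperconductivity.HubbardSuperconductivity.Theorems.KLProgrammeKLRegimeEnginePairTransferDLineEdgeTwoShellGen

/-!
# Route `KLProgramme` — ENGINE item stmt-HubbardSuperconductivity-20437 `KLRegimeEngineV17F2`, class-#5 STEP (X).3, located-risk #14 — «(X).3-TAIL-SHARP»:
# the pinned TAIL rows `WDd / WDx` IN THE ROOM's CURRENCY with the `min`-slot coefficient `3·c²·G²` (g20's `…DLineEdgeRoomReading` has `32·c²·G²`)
# (cell gate-hubbard-kl, seat hubbard-kl-k3c2-p2 g23; drop-in twins of `WDd/WDx_edge_row_le_slots` — SAME hypotheses, SAME shape, literal `3` for `32`)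

WHY.  The (X).3 one-call's pinned pair (k3c1-p1 «88b», S11″ `…ConvWDDPinnedAll`) books its sign-blind TAIL (`Λₙ₊₁ ≤ c·G·|transfer|_𝕋`, `c = 8` direct /
`16` crossed) through g20's `WDd/WDx_edge_row_le_slots`, i.e. `32c²G²·min` ⇒ tail constants `32855 = ⌈1155·2048/72⌉`, `65709 = ⌈2711·8192/338⌉` ⇒ under the A25 cap
`2²⁰(1+klTS)` the tail closes iff `(c₄/Klam)² ≤ 1.6` — a KNIFE-EDGE below the (c) lane's own a-priori budget `M4² ≤ 2³(KlamU)²` (register #14, pen (R305)).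
The `32` is the INTERIOR arithmetic `twoShell_factor_le_slots` (`κ = 4c`) read at the edge; it wastes three things that are free at the pinned pair:
(i) the near band `Λₙ₊₁/(cG) ≤ r < Λₙ₊₁` is compared with `Λ ≥ Λₙ₊₁` only, although the partner shell there is `Λₙ = 4Λₙ₊₁` (factor 4);
(ii) `(Λₙ + Gδ) ≤ 2Λₙ` although the row's own hypothesis is `Gδ ≤ Λₙ₊₁ = Λₙ/4` (factor 8/5);
(iii) the partner shell `ε₂′ = Λₙ` is t-independent against the slice-line prefactor `1/Λ(t)²`, worst at `t = 1`, where the slice line's support only forces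
`ε₂′ = max(Λ(t), 2Λₙ₊₁)` (`…DLineEdgeTwoShellGen`).  With all three, `Λₙ₊₁·(ε₂′(t) + Gδ)/Λ(t)² ≤ 3` uniformly in `t` (§1), hence:
* §1 `edge_twoShell_factor_le_slots` — `Λₙ = 4Λ₁`, `Λ₁ ≤ Λ(t) ≤ Λₙ`, `0 ≤ e ≤ Λ₁`, `Λ₁ ≤ c·G·r` (`1 ≤ c`, `4 ≤ G`), `0 < r`, `0 < β` ⇒
  `Λₙ/(βΛ(t)²)·((max(Λ(t), 2Λ₁) + e)/r + √(max(Λ(t), 2Λ₁) + e)) ≤ 16/(βΛₙ)·(3c²G²·min(r/Λ₁, Λ₁/r) + √(2Λₙ))`;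
* §2 **`WDd_edge_row_le_slots_sharp`** / **`WDx_edge_row_le_slots_sharp`** — EXACTLY the statements of `WDd/WDx_edge_row_le_slots` with `3 * c ^ 2 * G ^ 2` for
  `32 * c ^ 2 * G ^ 2`; `…_klTS` package instances.
NUMBERS (k3c1 CLASS5-RESOLVED-STEP §17 units, θ = 1/5, cap8 = 2²⁰(1+klTS)): direct `2048 ↦ 192` ⇒ `32855 ↦ ⌈1155·192/72⌉ = 3080`; crossed `8192 ↦ 768` ⇒
`65709 ↦ ⌈2711·768/338⌉ = 6160` ⇒ the tail closes iff `(c₄/Klam)² ≤ 0.09·2²⁰(1+klTS)/(6160·klTS) = 15.3·(1+klTS)/klTS`, ≥ 15.3 > 2³ for EVERY klTS — i.e. under the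
budget `M4² ≤ 2³(KlamU)²` the pinned TAIL is no longer a constraint (with the optional windows of …CrossedWide / …DirectSixth, `c = 8 / 6`: 61 / 54).
Pure real arithmetic over the companion; nothing about the model's kernel sizes is asserted; nothing asserts (X).3, (c), K3 or superconductivity.  0 kit · 0 lit.
-/

noncomputable section

namespace Summit.HubbardSuperconductivity.HubbardSuperconductivity.Theorems.KLRegimeSplit

set_option linter.dupNamespace false -- summit = problem name (single-conjunct summit), D-0017

open Real Finset Set Literature.MathematicalPhysics.QuantumLattice Literature.Probability.LatticeModels
open Literature.MathematicalPhysics.QuantumLattice.FermiRG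
open Summit.HubbardSuperconductivity.HubbardSuperconductivity.Theorems.KLProgrammeLegKernels
open Summit.HubbardSuperconductivity.HubbardSuperconductivity.Theorems.TwoPointAssembly
open Summit.HubbardSuperconductivity.HubbardSuperconductivity.Theorems.DispersionFlow
open Summit.HubbardSuperconductivity.HubbardSuperconductivity.Theorems.KLRegimeWick
open Summit.HubbardSuperconductivity.HubbardSuperconductivity.Theorems.EngineV8

/-! ## §1 Arithmetic: the edge two-shell factor in the slots' currency, t-uniformly -/

/-- **The edge two-shell factor in the slots' currency.**  `Λₙ = 4Λ₁` (`0 < Λ₁`), `Λ₁ ≤ Λ ≤ Λₙ` (the slice radius `Λ(t)`), `0 ≤ e ≤ Λ₁` (lattice fattening),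
`Λ₁ ≤ c·G·r` (tail regime, `1 ≤ c`, `4 ≤ G`), `0 < r`, `0 < β`:
`Λₙ/(βΛ²)·((max(Λ, 2Λ₁) + e)/r + √(max(Λ, 2Λ₁) + e)) ≤ 16/(βΛₙ)·(3c²G²·min(r/Λ₁, Λ₁/r) + √(2Λₙ))` — the dimensionless factor `Λ₁(max(Λ,2Λ₁) + e)/Λ² ≤ 3`
(cases `Λ ≤ 2Λ₁` / `2Λ₁ ≤ Λ`), then `Λ₁/r ≤ cG ≤ c²G²·(r/Λ₁)` in the near band and `Λ₁/r = min` in the far one. -/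
theorem edge_twoShell_factor_le_slots {Λn Λ₁ Λ G r e c β : ℝ} (hΛ₁ : 0 < Λ₁) (h4 : Λn = 4 * Λ₁) (hlo : Λ₁ ≤ Λ) (hhi : Λ ≤ Λn)
    (he0 : 0 ≤ e) (he : e ≤ Λ₁) (hc : 1 ≤ c) (hG : 4 ≤ G) (hr : 0 < r) (hthr : Λ₁ ≤ c * (G * r)) (hβ : 0 < β) :
    Λn / (β * Λ ^ 2) * ((max Λ (2 * Λ₁) + e) / r + Real.sqrt (max Λ (2 * Λ₁) + e)) ≤
      16 / (β * Λn) * (3 * c ^ 2 * G ^ 2 * min (r / Λ₁) (Λ₁ / r) + Real.sqrt (2 * Λn)) := by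
  subst h4
  have hΛ : 0 < Λ := hΛ₁.trans_le hlo
  set M : ℝ := max Λ (2 * Λ₁) + e with hM
  set mn : ℝ := min (r / Λ₁) (Λ₁ / r) with hmn
  have hM0 : 0 ≤ M := by rw [hM]; exact add_nonneg ((hΛ.le).trans (le_max_left _ _)) he0
  -- (Y) the dimensionless factor
  have hY : Λ₁ * M ≤ 3 * Λ ^ 2 := by
    rcases le_total Λ (2 * Λ₁) with h2 | h2
    · rw [hM, max_eq_right h2]; nlinarith
    · rw [hM, max_eq_left h2]; nlinarith
  -- (R) the near/far reading of `Λ₁/r`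
  have hcG : 1 ≤ c * G := by nlinarith
  have hR : Λ₁ / r ≤ c ^ 2 * G ^ 2 * mn := by
    rcases le_or_gt Λ₁ r with hfar | hnear
    · have hm : mn = Λ₁ / r := by
        rw [hmn]; exact min_eq_right (by rw [div_le_div_iff₀ hr hΛ₁]; nlinarith)
      rw [hm]
      have h1 : (1 : ℝ) ≤ c ^ 2 * G ^ 2 := by nlinarith
      have h2 : 0 ≤ Λ₁ / r := by positivity
      nlinarith
    · have hm : mn = r / Λ₁ := by
        rw [hmn]; exact min_eq_left (by rw [div_le_div_iff₀ hΛ₁ hr]; nlinarith)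
      rw [hm]
      have h1 : Λ₁ / r ≤ c * G := by rw [div_le_iff₀ hr]; linarith
      have h2 : 1 ≤ c * G * (r / Λ₁) := by
        rw [← mul_div_assoc, one_le_div hΛ₁]; linarith
      have h3 : 0 ≤ c * G := by linarith
      calc Λ₁ / r ≤ c * G := h1
        _ ≤ c * G * (c * G * (r / Λ₁)) := le_mul_of_one_le_right h3 h2
        _ = c ^ 2 * G ^ 2 * (r / Λ₁) := by ring
  -- term 1: the `1/r` part
  have t1 : 4 * Λ₁ / (β * Λ ^ 2) * (M / r) ≤ 12 / (β * r) := by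
    rw [div_mul_div_comm, div_le_div_iff₀ (by positivity) (by positivity)]
    have h := mul_le_mul_of_nonneg_left hY (by positivity : (0 : ℝ) ≤ 4 * β * r)
    nlinarith [h]
  have t1' : 12 / (β * r) ≤ 16 / (β * (4 * Λ₁)) * (3 * c ^ 2 * G ^ 2 * mn) := by
    rw [show 12 / (β * r) = 12 / (β * Λ₁) * (Λ₁ / r) by field_simp,
      show 16 / (β * (4 * Λ₁)) * (3 * c ^ 2 * G ^ 2 * mn) = 12 / (β * Λ₁) * (c ^ 2 * G ^ 2 * mn) by field_simp; ring]
    exact mul_le_mul_of_nonneg_left hR (by positivity)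
  -- term 2: the `√` part
  have t2a : 4 * Λ₁ / (β * Λ ^ 2) ≤ 16 / (β * (4 * Λ₁)) := by
    rw [div_le_div_iff₀ (by positivity) (by positivity)]
    have : Λ₁ * Λ₁ ≤ Λ ^ 2 := by nlinarith
    nlinarith [mul_pos hβ hΛ₁]
  have t2b : Real.sqrt M ≤ Real.sqrt (2 * (4 * Λ₁)) := Real.sqrt_le_sqrt (by
    rw [hM]; have := max_le hhi (by linarith : 2 * Λ₁ ≤ 4 * Λ₁); linarith)
  have t2 : 4 * Λ₁ / (β * Λ ^ 2) * Real.sqrt M ≤ 16 / (β * (4 * Λ₁)) * Real.sqrt (2 * (4 * Λ₁)) :=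
    mul_le_mul t2a t2b (Real.sqrt_nonneg _) (by positivity)
  calc 4 * Λ₁ / (β * Λ ^ 2) * (M / r + Real.sqrt M)
      = 4 * Λ₁ / (β * Λ ^ 2) * (M / r) + 4 * Λ₁ / (β * Λ ^ 2) * Real.sqrt M := by ring
    _ ≤ 16 / (β * (4 * Λ₁)) * (3 * c ^ 2 * G ^ 2 * mn) + 16 / (β * (4 * Λ₁)) * Real.sqrt (2 * (4 * Λ₁)) :=
        add_le_add (t1.trans t1') t2
    _ = 16 / (β * (4 * Λ₁)) * (3 * c ^ 2 * G ^ 2 * mn + Real.sqrt (2 * (4 * Λ₁))) := by ring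

/-- The merged reading (algebra): `C·A·((16/(βΛₙ))·S·((βΛ_{j′}/π)·T)) = C·A·(16Λ_{j′}/Λₙ)/π·T·S`. -/
theorem edge_reading_eq {C A β Λn Λj S T : ℝ} (hβ : β ≠ 0) (hΛn : Λn ≠ 0) :
    C * A * ((16 / (β * Λn) * S) * (β * Λj / π * T)) = C * A * (16 * (Λj / Λn)) / π * T * S := by
  have hπ := Real.pi_ne_zero
  field_simp

/-! ## §2 The pinned TAIL rows in the ROOM's currency with coefficient `3c²G²` -/

variable {L M : ℕ} (β μ : ℝ) (K : TrigPolyC4v)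

/-- **THE DIRECT `D`-ROW IN THE SLOTS' CURRENCY, EVERY PAIR `n + 1 ≤ j′ ≤ j`, TAIL REGIME `Λₙ₊₁ ≤ c·G·|x − y|_𝕋` (`1 ≤ c`).**  `π/(4β) ≤ Λ_{j′}`,
`t ∈ [0,1]`, `Gδ ≤ Λₙ₊₁`, `Λₙ + Gδ ≤ klE0` (`G = 4 + (8/3)Gfr₁U²`, `δ = 2π/L`):
`(Λₙ−Λₙ₊₁)·((βL²)³)⁻¹·WDd(t,x,y) ≤ (512/3)(27/(8π²))·A·(16·Λ_{j′}/Λₙ)/π·(10 + 50Gβ/L)·(3c²·G²·min(|x−y|_𝕋/Λₙ₊₁, Λₙ₊₁/|x−y|_𝕋) + 2⁻ⁿ/4)`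
— `WDd_edge_row_le_slots` with `3c²G²` for `32c²G²` (t-dependent partner shell `max(Λ(t), 2Λₙ₊₁)` + the edge arithmetic of §1); `c = 8 ↦ 192`, `c = 16 ↦ 768`. -/
theorem WDd_edge_row_le_slots_sharp [NeZero L] [NeZero M] {A : ℝ} {u : RenConsts → ℝ} (h : TwoShellFrameAreaAt A u)
    (hA : 0 ≤ A) {R : RenConsts} (hR : R.WF2) {U : ℝ} (hU : 0 < U) (hUu : U ≤ u R) (hμ : μ ∈ klWindowC) {N : ℕ} (hK : FrameOK R U N μ K)
    (hβ : 0 < β) (n : ℕ) {j j' : ℕ} (hj' : n + 1 ≤ j') (hjj : j' ≤ j) (hj'β : π / (4 * β) ≤ klScale klE0 j') {t : ℝ} (ht : t ∈ Icc (0 : ℝ) 1)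
    (hGδ : (4 + 8 / 3 * R.Gfr 1 * U ^ 2) * (2 * π / L) ≤ klScale klE0 (n + 1))
    (hE0 : klScale klE0 n + (4 + 8 / 3 * R.Gfr 1 * U ^ 2) * (2 * π / L) ≤ klE0) (x y : TorusSite 2 L)
    {c : ℝ} (hc : 1 ≤ c) (htail : klScale klE0 (n + 1) ≤ c * ((4 + 8 / 3 * R.Gfr 1 * U ^ 2) * klTorusNorm L (x - y))) :
    (klScale klE0 n - klScale klE0 (n + 1)) * ((β * (L : ℝ) ^ 2) ^ 3)⁻¹ *
      ∑ p : FreqMomentum L M, ∑ _σ : Fin 2, ∑ p' : FreqMomentum L M,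
        (if matsubaraInt M p'.1 + matsubaraInt M (omega0 M) = matsubaraInt M p.1 + matsubaraInt M (omega0 M) ∧ p'.2 = p.2 + x - y then
          ‖((((softSymbolCompl L M β μ K (n + 1) j p - softSymbolCompl L M β μ K (n + 1) j' p : ℝ)) : ℂ) * (((β * (L : ℝ) ^ 2 : ℝ) : ℂ) * propCT L M β μ K p)) *
              ((((deriv (fun Λ' : ℝ => hubbardCutoffWeightCT L M β μ K Λ' p') (klScale klE0 n + t * (klScale klE0 (n + 1) - klScale klE0 n)) : ℝ)) : ℂ) *
                (((β * (L : ℝ) ^ 2 : ℝ) : ℂ) * propCT L M β μ K p')) +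
            ((((deriv (fun Λ' : ℝ => hubbardCutoffWeightCT L M β μ K Λ' p) (klScale klE0 n + t * (klScale klE0 (n + 1) - klScale klE0 n)) : ℝ)) : ℂ) *
                (((β * (L : ℝ) ^ 2 : ℝ) : ℂ) * propCT L M β μ K p)) *
              ((((softSymbolCompl L M β μ K (n + 1) j p' - softSymbolCompl L M β μ K (n + 1) j' p' : ℝ)) : ℂ) * (((β * (L : ℝ) ^ 2 : ℝ) : ℂ) * propCT L M β μ K p'))‖
        else 0) ≤
      512 / 3 * (27 / (8 * π ^ 2)) * A * (16 * (klScale klE0 j' / klScale klE0 n)) / π * (10 + 50 * (4 + 8 / 3 * R.Gfr 1 * U ^ 2) * β / L) *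
        (3 * c ^ 2 * (4 + 8 / 3 * R.Gfr 1 * U ^ 2) ^ 2 * min (klTorusNorm L (x - y) / klScale klE0 (n + 1)) (klScale klE0 (n + 1) / klTorusNorm L (x - y)) +
          ((2 : ℝ) ^ n)⁻¹ / 4) := by
  have hπ := Real.pi_pos
  have hL : (0 : ℝ) < L := by exact_mod_cast Nat.pos_of_ne_zero (NeZero.ne L)
  have hGfr : ∀ j, 0 ≤ R.Gfr j := hR.wf.2.2
  set G : ℝ := 4 + 8 / 3 * R.Gfr 1 * U ^ 2 with hG
  have hG4 : 4 ≤ G := by rw [hG]; nlinarith [hGfr 1, sq_nonneg U]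
  have hG0 : 0 ≤ G := by linarith
  set Λ : ℝ := klScale klE0 n + t * (klScale klE0 (n + 1) - klScale klE0 n) with hΛdef
  have hΛ : 0 < Λ := scaleAt_pos n ht
  obtain ⟨hΛlo, hΛhi⟩ := scaleAt_mem n ht
  rw [← hΛdef] at hΛlo hΛhi
  have hΛn := klth_klScale_pos n
  have hΛ1 := klth_klScale_pos (n + 1)
  have hΛj := klth_klScale_pos j'
  have hsucc : klScale klE0 (n + 1) = klScale klE0 n / 4 := klth_klScale_succ n
  set r : ℝ := klTorusNorm L (x - y) with hr
  have hr0 : 0 ≤ r := by rw [hr]; unfold klTorusNorm KLProgrammeLegKernels.torusSupNorm torusAbs; positivity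
  set mn : ℝ := min (r / klScale klE0 (n + 1)) (klScale klE0 (n + 1) / r) with hmn
  have hmn0 : 0 ≤ mn := le_min (by positivity) (by positivity)
  have hrpos : 0 < r := by
    by_contra h0; push Not at h0
    have h1 : G * r ≤ 0 := mul_nonpos_of_nonneg_of_nonpos hG0 h0
    have h2 : c * (G * r) ≤ 0 := mul_nonpos_of_nonneg_of_nonpos (by linarith) h1
    linarith
  -- the two-shell law at the t-dependent partner radius `ε₂′ = max(Λ(t), 2Λₙ₊₁)`
  have hj'1 : klScale klE0 j' ≤ klScale klE0 (n + 1) := klld_klScale_anti hj'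
  have h2Λ : 2 * klScale klE0 j' ≤ max Λ (2 * klScale klE0 (n + 1)) := le_max_of_le_right (by linarith)
  have h21 : 2 * klScale klE0 (n + 1) ≤ klScale klE0 n := by rw [hsucc]; linarith
  have hE0' : max Λ (2 * klScale klE0 (n + 1)) + G * (2 * π / L) ≤ klE0 :=
    le_trans (by linarith [max_le hΛhi h21]) hE0
  have hbound := WDd_sum_le_twoShell_edge_gen (L := L) (M := M) β μ K h hA hR hU hUu hμ hK hβ n hjj ht (le_max_left _ _) h2Λ hE0' hrpos (le_refl r)
  rw [← hΛdef] at hbound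
  -- the slots reading of the edge factor (§1) and of the bracket
  have hfac : klScale klE0 n / (β * Λ ^ 2) * ((max Λ (2 * klScale klE0 (n + 1)) + G * (2 * π / L)) / r +
      Real.sqrt (max Λ (2 * klScale klE0 (n + 1)) + G * (2 * π / L))) ≤ 16 / (β * klScale klE0 n) * (3 * c ^ 2 * G ^ 2 * mn + ((2 : ℝ) ^ n)⁻¹ / 4) := by
    have h := edge_twoShell_factor_le_slots (Λn := klScale klE0 n) (Λ₁ := klScale klE0 (n + 1)) (Λ := Λ) (e := G * (2 * π / L)) (c := c) (G := G)
      (r := r) (β := β) hΛ1 (by rw [hsucc]; ring) hΛlo hΛhi (by positivity) hGδ hc hG4 hrpos (by linarith) hβ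
    rw [sqrt_two_mul_klScale_eq n] at h
    rw [hmn]; exact h
  set E : ℝ := max Λ (2 * klScale klE0 (n + 1)) with hE
  have hB := bracket_le (Λ' := klScale klE0 j') hβ hL hG0 hj'β
  have hBnn : 0 ≤ β * klScale klE0 j' / π * (10 + 2 * G * β / L) + 12 * G * β / L := by positivity
  -- multiply out
  have hpre : 0 ≤ (klScale klE0 n - klScale klE0 (n + 1)) * ((β * (L : ℝ) ^ 2) ^ 3)⁻¹ := by
    rw [hsucc]; have : 0 ≤ klScale klE0 n - klScale klE0 n / 4 := by linarith
    positivity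
  refine (mul_le_mul_of_nonneg_left hbound hpre).trans ?_
  rw [hsucc, prefactor_eq hβ hL hΛ]
  -- compare factor by factor
  have hSnn : 0 ≤ 16 / (β * klScale klE0 n) * (3 * c ^ 2 * G ^ 2 * mn + ((2 : ℝ) ^ n)⁻¹ / 4) := by positivity
  have hCA : 0 ≤ 512 / 3 * (27 / (8 * π ^ 2)) * A := by positivity
  calc 512 / 3 * (27 / (8 * π ^ 2)) * A * (klScale klE0 n / (β * Λ ^ 2)) * ((E + G * (2 * π / L)) / r + Real.sqrt (E + G * (2 * π / L))) *
        (β * klScale klE0 j' / π * (10 + 2 * G * β / L) + 12 * G * β / L)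
      = 512 / 3 * (27 / (8 * π ^ 2)) * A * ((klScale klE0 n / (β * Λ ^ 2) * ((E + G * (2 * π / L)) / r + Real.sqrt (E + G * (2 * π / L)))) *
        (β * klScale klE0 j' / π * (10 + 2 * G * β / L) + 12 * G * β / L)) := by ring
    _ ≤ 512 / 3 * (27 / (8 * π ^ 2)) * A * ((16 / (β * klScale klE0 n) * (3 * c ^ 2 * G ^ 2 * mn + ((2 : ℝ) ^ n)⁻¹ / 4)) *
        (β * klScale klE0 j' / π * (10 + 50 * G * β / L))) := mul_le_mul_of_nonneg_left (mul_le_mul hfac hB hBnn hSnn) hCA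
    _ = 512 / 3 * (27 / (8 * π ^ 2)) * A * (16 * (klScale klE0 j' / klScale klE0 n)) / π * (10 + 50 * G * β / L) *
        (3 * c ^ 2 * G ^ 2 * mn + ((2 : ℝ) ^ n)⁻¹ / 4) := edge_reading_eq hβ.ne' hΛn.ne'

/-- **THE CROSSED `D`-ROW IN THE SLOTS' CURRENCY, EVERY PAIR `n + 1 ≤ j′ ≤ j`, TAIL REGIME `Λₙ₊₁ ≤ c·G·|x + y − Q_m|_𝕋`, coefficient `3c²G²`**
(`1 ≤ c`; twin of `WDd_edge_row_le_slots_sharp` at transfer `x + y − Q_m`, half the prefactor; `WDx_edge_row_le_slots` with `3` for `32`). -/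
theorem WDx_edge_row_le_slots_sharp [NeZero L] [NeZero M] {A : ℝ} {u : RenConsts → ℝ} (h : TwoShellFrameAreaAt A u)
    (hA : 0 ≤ A) {R : RenConsts} (hR : R.WF2) {U : ℝ} (hU : 0 < U) (hUu : U ≤ u R) (hμ : μ ∈ klWindowC) {N : ℕ} (hK : FrameOK R U N μ K)
    (hβ : 0 < β) (n : ℕ) {j j' : ℕ} (hj' : n + 1 ≤ j') (hjj : j' ≤ j) (hj'β : π / (4 * β) ≤ klScale klE0 j') {t : ℝ} (ht : t ∈ Icc (0 : ℝ) 1)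
    (hGδ : (4 + 8 / 3 * R.Gfr 1 * U ^ 2) * (2 * π / L) ≤ klScale klE0 (n + 1))
    (hE0 : klScale klE0 n + (4 + 8 / 3 * R.Gfr 1 * U ^ 2) * (2 * π / L) ≤ klE0) (Qm x y : TorusSite 2 L)
    {c : ℝ} (hc : 1 ≤ c) (htail : klScale klE0 (n + 1) ≤ c * ((4 + 8 / 3 * R.Gfr 1 * U ^ 2) * klTorusNorm L (x + y - Qm))) :
    (klScale klE0 n - klScale klE0 (n + 1)) * ((β * (L : ℝ) ^ 2) ^ 3)⁻¹ *
      ∑ p : FreqMomentum L M, ∑ p' : FreqMomentum L M,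
        (if matsubaraInt M p'.1 + matsubaraInt M (omega0 M) + matsubaraInt M (omega0 M) + 1 = matsubaraInt M p.1 ∧ p'.2 = p.2 + Qm - x - y then
          ‖((((softSymbolCompl L M β μ K (n + 1) j p - softSymbolCompl L M β μ K (n + 1) j' p : ℝ)) : ℂ) * (((β * (L : ℝ) ^ 2 : ℝ) : ℂ) * propCT L M β μ K p)) *
              ((((deriv (fun Λ' : ℝ => hubbardCutoffWeightCT L M β μ K Λ' p') (klScale klE0 n + t * (klScale klE0 (n + 1) - klScale klE0 n)) : ℝ)) : ℂ) *
                (((β * (L : ℝ) ^ 2 : ℝ) : ℂ) * propCT L M β μ K p')) +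
            ((((deriv (fun Λ' : ℝ => hubbardCutoffWeightCT L M β μ K Λ' p) (klScale klE0 n + t * (klScale klE0 (n + 1) - klScale klE0 n)) : ℝ)) : ℂ) *
                (((β * (L : ℝ) ^ 2 : ℝ) : ℂ) * propCT L M β μ K p)) *
              ((((softSymbolCompl L M β μ K (n + 1) j p' - softSymbolCompl L M β μ K (n + 1) j' p' : ℝ)) : ℂ) * (((β * (L : ℝ) ^ 2 : ℝ) : ℂ) * propCT L M β μ K p'))‖
        else 0) ≤
      256 / 3 * (27 / (8 * π ^ 2)) * A * (16 * (klScale klE0 j' / klScale klE0 n)) / π * (10 + 50 * (4 + 8 / 3 * R.Gfr 1 * U ^ 2) * β / L) *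
        (3 * c ^ 2 * (4 + 8 / 3 * R.Gfr 1 * U ^ 2) ^ 2 * min (klTorusNorm L (x + y - Qm) / klScale klE0 (n + 1)) (klScale klE0 (n + 1) / klTorusNorm L (x + y - Qm)) +
          ((2 : ℝ) ^ n)⁻¹ / 4) := by
  have hπ := Real.pi_pos
  have hL : (0 : ℝ) < L := by exact_mod_cast Nat.pos_of_ne_zero (NeZero.ne L)
  have hGfr : ∀ j, 0 ≤ R.Gfr j := hR.wf.2.2
  set G : ℝ := 4 + 8 / 3 * R.Gfr 1 * U ^ 2 with hG
  have hG4 : 4 ≤ G := by rw [hG]; nlinarith [hGfr 1, sq_nonneg U]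
  have hG0 : 0 ≤ G := by linarith
  set Λ : ℝ := klScale klE0 n + t * (klScale klE0 (n + 1) - klScale klE0 n) with hΛdef
  have hΛ : 0 < Λ := scaleAt_pos n ht
  obtain ⟨hΛlo, hΛhi⟩ := scaleAt_mem n ht
  rw [← hΛdef] at hΛlo hΛhi
  have hΛn := klth_klScale_pos n
  have hΛ1 := klth_klScale_pos (n + 1)
  have hΛj := klth_klScale_pos j'
  have hsucc : klScale klE0 (n + 1) = klScale klE0 n / 4 := klth_klScale_succ n
  set r : ℝ := klTorusNorm L (x + y - Qm) with hr
  have hr0 : 0 ≤ r := by rw [hr]; unfold klTorusNorm KLProgrammeLegKernels.torusSupNorm torusAbs; positivity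
  set mn : ℝ := min (r / klScale klE0 (n + 1)) (klScale klE0 (n + 1) / r) with hmn
  have hmn0 : 0 ≤ mn := le_min (by positivity) (by positivity)
  have hrpos : 0 < r := by
    by_contra h0; push Not at h0
    have h1 : G * r ≤ 0 := mul_nonpos_of_nonneg_of_nonpos hG0 h0
    have h2 : c * (G * r) ≤ 0 := mul_nonpos_of_nonneg_of_nonpos (by linarith) h1
    linarith
  -- the two-shell law at the t-dependent partner radius `ε₂′ = max(Λ(t), 2Λₙ₊₁)`
  have hj'1 : klScale klE0 j' ≤ klScale klE0 (n + 1) := klld_klScale_anti hj'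
  have h2Λ : 2 * klScale klE0 j' ≤ max Λ (2 * klScale klE0 (n + 1)) := le_max_of_le_right (by linarith)
  have h21 : 2 * klScale klE0 (n + 1) ≤ klScale klE0 n := by rw [hsucc]; linarith
  have hE0' : max Λ (2 * klScale klE0 (n + 1)) + G * (2 * π / L) ≤ klE0 :=
    le_trans (by linarith [max_le hΛhi h21]) hE0
  have hbound := WDx_sum_le_twoShell_edge_gen (L := L) (M := M) β μ K h hA hR hU hUu hμ hK hβ n hjj ht (le_max_left _ _) h2Λ hE0' hrpos (le_refl r)
  rw [← hΛdef] at hbound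
  -- the slots reading of the edge factor (§1) and of the bracket
  have hfac : klScale klE0 n / (β * Λ ^ 2) * ((max Λ (2 * klScale klE0 (n + 1)) + G * (2 * π / L)) / r +
      Real.sqrt (max Λ (2 * klScale klE0 (n + 1)) + G * (2 * π / L))) ≤ 16 / (β * klScale klE0 n) * (3 * c ^ 2 * G ^ 2 * mn + ((2 : ℝ) ^ n)⁻¹ / 4) := by
    have h := edge_twoShell_factor_le_slots (Λn := klScale klE0 n) (Λ₁ := klScale klE0 (n + 1)) (Λ := Λ) (e := G * (2 * π / L)) (c := c) (G := G)
      (r := r) (β := β) hΛ1 (by rw [hsucc]; ring) hΛlo hΛhi (by positivity) hGδ hc hG4 hrpos (by linarith) hβ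
    rw [sqrt_two_mul_klScale_eq n] at h
    rw [hmn]; exact h
  set E : ℝ := max Λ (2 * klScale klE0 (n + 1)) with hE
  have hB := bracket_le (Λ' := klScale klE0 j') hβ hL hG0 hj'β
  have hBnn : 0 ≤ β * klScale klE0 j' / π * (10 + 2 * G * β / L) + 12 * G * β / L := by positivity
  have hpre : 0 ≤ (klScale klE0 n - klScale klE0 (n + 1)) * ((β * (L : ℝ) ^ 2) ^ 3)⁻¹ := by
    rw [hsucc]; have : 0 ≤ klScale klE0 n - klScale klE0 n / 4 := by linarith
    positivity
  refine (mul_le_mul_of_nonneg_left hbound hpre).trans ?_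
  rw [hsucc, prefactor_eq hβ hL hΛ]
  have hSnn : 0 ≤ 16 / (β * klScale klE0 n) * (3 * c ^ 2 * G ^ 2 * mn + ((2 : ℝ) ^ n)⁻¹ / 4) := by positivity
  have hCA : 0 ≤ 256 / 3 * (27 / (8 * π ^ 2)) * A := by positivity
  calc 256 / 3 * (27 / (8 * π ^ 2)) * A * (klScale klE0 n / (β * Λ ^ 2)) * ((E + G * (2 * π / L)) / r + Real.sqrt (E + G * (2 * π / L))) *
        (β * klScale klE0 j' / π * (10 + 2 * G * β / L) + 12 * G * β / L)
      = 256 / 3 * (27 / (8 * π ^ 2)) * A * ((klScale klE0 n / (β * Λ ^ 2) * ((E + G * (2 * π / L)) / r + Real.sqrt (E + G * (2 * π / L)))) *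
        (β * klScale klE0 j' / π * (10 + 2 * G * β / L) + 12 * G * β / L)) := by ring
    _ ≤ 256 / 3 * (27 / (8 * π ^ 2)) * A * ((16 / (β * klScale klE0 n) * (3 * c ^ 2 * G ^ 2 * mn + ((2 : ℝ) ^ n)⁻¹ / 4)) *
        (β * klScale klE0 j' / π * (10 + 50 * G * β / L))) := mul_le_mul_of_nonneg_left (mul_le_mul hfac hB hBnn hSnn) hCA
    _ = 256 / 3 * (27 / (8 * π ^ 2)) * A * (16 * (klScale klE0 j' / klScale klE0 n)) / π * (10 + 50 * G * β / L) *
        (3 * c ^ 2 * G ^ 2 * mn + ((2 : ℝ) ^ n)⁻¹ / 4) := edge_reading_eq hβ.ne' hΛn.ne'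

/-! ## §3 The package instances -/

/-- **The package instance of the sharp direct edge/tail row** (`A = klTS`, `u = klTSU`). -/
theorem WDd_edge_row_le_slots_sharp_klTS [NeZero L] [NeZero M] {R : RenConsts} (hR : R.WF2) {U : ℝ} (hU : 0 < U) (hUu : U ≤ klTSU R)
    (hμ : μ ∈ klWindowC) {N : ℕ} (hK : FrameOK R U N μ K) (hβ : 0 < β) (n : ℕ) {j j' : ℕ} (hj' : n + 1 ≤ j') (hjj : j' ≤ j)
    (hj'β : π / (4 * β) ≤ klScale klE0 j') {t : ℝ} (ht : t ∈ Icc (0 : ℝ) 1)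
    (hGδ : (4 + 8 / 3 * R.Gfr 1 * U ^ 2) * (2 * π / L) ≤ klScale klE0 (n + 1))
    (hE0 : klScale klE0 n + (4 + 8 / 3 * R.Gfr 1 * U ^ 2) * (2 * π / L) ≤ klE0) (x y : TorusSite 2 L)
    {c : ℝ} (hc : 1 ≤ c) (htail : klScale klE0 (n + 1) ≤ c * ((4 + 8 / 3 * R.Gfr 1 * U ^ 2) * klTorusNorm L (x - y))) :
    (klScale klE0 n - klScale klE0 (n + 1)) * ((β * (L : ℝ) ^ 2) ^ 3)⁻¹ *
      ∑ p : FreqMomentum L M, ∑ _σ : Fin 2, ∑ p' : FreqMomentum L M,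
        (if matsubaraInt M p'.1 + matsubaraInt M (omega0 M) = matsubaraInt M p.1 + matsubaraInt M (omega0 M) ∧ p'.2 = p.2 + x - y then
          ‖((((softSymbolCompl L M β μ K (n + 1) j p - softSymbolCompl L M β μ K (n + 1) j' p : ℝ)) : ℂ) * (((β * (L : ℝ) ^ 2 : ℝ) : ℂ) * propCT L M β μ K p)) *
              ((((deriv (fun Λ' : ℝ => hubbardCutoffWeightCT L M β μ K Λ' p') (klScale klE0 n + t * (klScale klE0 (n + 1) - klScale klE0 n)) : ℝ)) : ℂ) *
                (((β * (L : ℝ) ^ 2 : ℝ) : ℂ) * propCT L M β μ K p')) +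
            ((((deriv (fun Λ' : ℝ => hubbardCutoffWeightCT L M β μ K Λ' p) (klScale klE0 n + t * (klScale klE0 (n + 1) - klScale klE0 n)) : ℝ)) : ℂ) *
                (((β * (L : ℝ) ^ 2 : ℝ) : ℂ) * propCT L M β μ K p)) *
              ((((softSymbolCompl L M β μ K (n + 1) j p' - softSymbolCompl L M β μ K (n + 1) j' p' : ℝ)) : ℂ) * (((β * (L : ℝ) ^ 2 : ℝ) : ℂ) * propCT L M β μ K p'))‖
        else 0) ≤
      512 / 3 * (27 / (8 * π ^ 2)) * klTS * (16 * (klScale klE0 j' / klScale klE0 n)) / π * (10 + 50 * (4 + 8 / 3 * R.Gfr 1 * U ^ 2) * β / L) *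
        (3 * c ^ 2 * (4 + 8 / 3 * R.Gfr 1 * U ^ 2) ^ 2 * min (klTorusNorm L (x - y) / klScale klE0 (n + 1)) (klScale klE0 (n + 1) / klTorusNorm L (x - y)) +
          ((2 : ℝ) ^ n)⁻¹ / 4) :=
  WDd_edge_row_le_slots_sharp β μ K twoShellFrameAreaAt_klTS klTS_nonneg hR hU hUu hμ hK hβ n hj' hjj hj'β ht hGδ hE0 x y hc htail

/-- **The package instance of the sharp crossed edge/tail row** (`A = klTS`, `u = klTSU`). -/
theorem WDx_edge_row_le_slots_sharp_klTS [NeZero L] [NeZero M] {R : RenConsts} (hR : R.WF2) {U : ℝ} (hU : 0 < U) (hUu : U ≤ klTSU R)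
    (hμ : μ ∈ klWindowC) {N : ℕ} (hK : FrameOK R U N μ K) (hβ : 0 < β) (n : ℕ) {j j' : ℕ} (hj' : n + 1 ≤ j') (hjj : j' ≤ j)
    (hj'β : π / (4 * β) ≤ klScale klE0 j') {t : ℝ} (ht : t ∈ Icc (0 : ℝ) 1)
    (hGδ : (4 + 8 / 3 * R.Gfr 1 * U ^ 2) * (2 * π / L) ≤ klScale klE0 (n + 1))
    (hE0 : klScale klE0 n + (4 + 8 / 3 * R.Gfr 1 * U ^ 2) * (2 * π / L) ≤ klE0) (Qm x y : TorusSite 2 L)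
    {c : ℝ} (hc : 1 ≤ c) (htail : klScale klE0 (n + 1) ≤ c * ((4 + 8 / 3 * R.Gfr 1 * U ^ 2) * klTorusNorm L (x + y - Qm))) :
    (klScale klE0 n - klScale klE0 (n + 1)) * ((β * (L : ℝ) ^ 2) ^ 3)⁻¹ *
      ∑ p : FreqMomentum L M, ∑ p' : FreqMomentum L M,
        (if matsubaraInt M p'.1 + matsubaraInt M (omega0 M) + matsubaraInt M (omega0 M) + 1 = matsubaraInt M p.1 ∧ p'.2 = p.2 + Qm - x - y then
          ‖((((softSymbolCompl L M β μ K (n + 1) j p - softSymbolCompl L M β μ K (n + 1) j' p : ℝ)) : ℂ) * (((β * (L : ℝ) ^ 2 : ℝ) : ℂ) * propCT L M β μ K p)) *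
              ((((deriv (fun Λ' : ℝ => hubbardCutoffWeightCT L M β μ K Λ' p') (klScale klE0 n + t * (klScale klE0 (n + 1) - klScale klE0 n)) : ℝ)) : ℂ) *
                (((β * (L : ℝ) ^ 2 : ℝ) : ℂ) * propCT L M β μ K p')) +
            ((((deriv (fun Λ' : ℝ => hubbardCutoffWeightCT L M β μ K Λ' p) (klScale klE0 n + t * (klScale klE0 (n + 1) - klScale klE0 n)) : ℝ)) : ℂ) *
                (((β * (L : ℝ) ^ 2 : ℝ) : ℂ) * propCT L M β μ K p)) *
              ((((softSymbolCompl L M β μ K (n + 1) j p' - softSymbolCompl L M β μ K (n + 1) j' p' : ℝ)) : ℂ) * (((β * (L : ℝ) ^ 2 : ℝ) : ℂ) * propCT L M β μ K p'))‖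
        else 0) ≤
      256 / 3 * (27 / (8 * π ^ 2)) * klTS * (16 * (klScale klE0 j' / klScale klE0 n)) / π * (10 + 50 * (4 + 8 / 3 * R.Gfr 1 * U ^ 2) * β / L) *
        (3 * c ^ 2 * (4 + 8 / 3 * R.Gfr 1 * U ^ 2) ^ 2 * min (klTorusNorm L (x + y - Qm) / klScale klE0 (n + 1)) (klScale klE0 (n + 1) / klTorusNorm L (x + y - Qm)) +
          ((2 : ℝ) ^ n)⁻¹ / 4) :=
  WDx_edge_row_le_slots_sharp β μ K twoShellFrameAreaAt_klTS klTS_nonneg hR hU hUu hμ hK hβ n hj' hjj hj'β ht hGδ hE0 Qm x y hc htail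

end Summit.HubbardSuperconductivity.HubbardSuperconductivity.Theorems.KLRegimeSplit

end
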